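import Mathlib
import Summits.NavierStokesRegularity.NavierStokesRegularity.Theses.HeteroclinicTriggerChain
import HarnessLib

/-!
# RESTATEMENT DRAFT (width seat ns-htc-p4 g0) for crux `TriggerChainFrontStep` (stmt-NavierStokesRegularity-22785)

NS regularity is not proved by anything here; MODEL lattice only; this is a PLANNER-FACING draft, not a route edit.

`TriggerChainFrontStepJ` = the crux with two extra hypotheses appended to the chain bundle (after the (seed) clause):
 (J1) junk-free connection   `∀ i t, i ≠ i₀ → i ≠ i₁ → H i 0 t = 0`;
 (J2) sector invariance      `∀ X, (∀ i n t, i ≠ i₀ → i ≠ i₁ → X i n t = 0) → ∀ j n t, j ≠ i₀ → j ≠ i₁ →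
                              quadTerm 1 α₀ X j n t = 0 ∧ quadTerm 1 σ X j n t = 0`.
`TriggerChainTableJ` = the companion existential crux with the same two clauses (K2's explicit witness satisfies both: its
`quadTerm` rows of the idle modes vanish identically, `heteroclinicTriggerChain_quadTerm_trigger/_seed`, and its `H` is
supported on the three arc slots).  `TriggerChainFrontStep → TriggerChainFrontStepJ` is trivial (more hypotheses), so the
restated crux is WEAKER (at least as provable); the assembly is unchanged with (TableJ, FrontStepJ) in place of (Table, FrontStep).
Why: see Cruxes/TriggerChainFrontStep/CONNECTIONFORM-p4.md — without (J1)/(J2) the hypotheses admit junk-excursion connections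
(g < e) and overlap-triad leaks, so the hop map is not the 4-dim seeded truncation; with them the pinned table on the sector is
exactly e·(K2 design) + β·(seed triad), g = e, H = logistic arc (tree: …ConnectionArc, …SectorRows, …SectorInvariance).
-/

namespace Summit.NavierStokesRegularity.NavierStokesRegularity.Cruxes.TriggerChainFrontStep.RestatementP4

/-- K1 with (J1) junk-free connection and (J2) sector invariance appended (draft). -/
def TriggerChainFrontStepJ : Prop :=
  ∀ R : ℝ, 1 ≤ R → ∀ α₀ σ : Fin 4 → Fin 4 → Fin 4 → ℤ × ℤ × ℤ → ℝ, (Literature.Analysis.FluidPDE.TaoCascade.InTableClass R α₀ ∧ (∀ β : ℝ, 0 < β → β ≤ 1 → Literature.Analysis.FluidPDE.TaoCascade.InTableClass (R / β) (fun j₁ j₂ j₃ μ => α₀ j₁ j₂ j₃ μ + β * σ j₁ j₂ j₃ μ)) ∧ ∃ (i₀ i₁ : Fin 4) (e κ K : ℝ) (d : Fin 4 → ℤ → ℝ) (H : Fin 4 → ℤ → ℝ → ℝ), i₀ ≠ i₁ ∧ 0 < e ∧ 0 < κ ∧ 0 < K ∧ (∀ X : Fin 4 → ℤ → ℝ → ℝ,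 (∀ i n t, i ≠ i₀ → X i n t = 0) → ∀ i n t, Literature.Analysis.FluidPDE.TaoCascade.quadTerm 1 α₀ X i n t = 0 ∧ Literature.Analysis.FluidPDE.TaoCascade.quadTerm 1 σ X i n t = 0) ∧ (∀ (j₁ j₂ j₃ : Fin 4) (μ : ℤ × ℤ × ℤ), Xor' (Xor' (j₁ = i₁) (j₂ = i₁)) (j₃ = i₁) → α₀ j₁ j₂ j₃ μ = 0 ∧ σ j₁ j₂ j₃ μ = 0) ∧ (∀ (Y : Fin 4 → ℤ → ℝ → ℝ) (i : Fin 4) (n : ℤ) (t : ℝ), Literature.Analysis.FluidPDE.TaoCascade.quadTerm 1 α₀ (fun j m s => (fun j m (_ : ℝ) => if j = i₀ ∧ m = 0 then (1 : ℝ) else 0) j m s + Y j m s) i n t - Literature.Analysis.FluidPDE.TaoCascade.quadTerm 1 α₀ (fun j m (_ : ℝ) => if j = i₀ ∧ m = 0 then (1 : ℝ) else 0) i n t - Literature.Analysis.FluidPDE.TaoCascade.quadTerm 1 α₀ Y i n t = d i n * Y i n t) ∧ d i₁ 0 = e ∧ (∀ i n, ¬ (i = i₁ ∧ n = 0) → d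 i n ≤ 0) ∧ (∀ i n t, HasDerivAt (H i n) (Literature.Analysis.FluidPDE.TaoCascade.quadTerm 1 α₀ H i n t) t) ∧ (∀ i n t, n < 0 → H i n t = 0) ∧ (∀ i n t, 1 ≤ n → i ≠ i₀ → H i n t = 0) ∧ (∀ i n t, 2 ≤ n → H i n t = 0) ∧ (∀ i n, Filter.Tendsto (H i n) Filter.atBot (nhds (if i = i₀ ∧ n = 0 then (1 : ℝ) else 0))) ∧ (∀ i n, Filter.Tendsto (H i n) Filter.atTop (nhds (if i = i₀ ∧ n = 1 then (1 : ℝ) else 0))) ∧ (∀ i n t, t ≤ 0 → |H i n t - (if i = i₀ ∧ n = 0 then (1 : ℝ) else 0)| ≤ K * Real.exp (e * t)) ∧ (∀ t : ℝ, t ≤ 0 → K⁻¹ * Real.exp (e * t) ≤ |H i₁ 0 t|) ∧ (∀ i n t, 0 ≤ t → |H i n t - (if i = i₀ ∧ n = 1 then (1 : ℝ) else 0)| ≤ K * Real.exp (-(κ * t))) ∧ (∃ t : ℝ, Literature.Analysis.FluidPDE.TaoCascade.quadTerm 1 σ H i₁ 1 t ≠ 0) ∧ (∀ (i : Fin 4)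 (t : ℝ), i ≠ i₀ → i ≠ i₁ → H i 0 t = 0) ∧ (∀ X : Fin 4 → ℤ → ℝ → ℝ, (∀ i n t, i ≠ i₀ → i ≠ i₁ → X i n t = 0) → ∀ (j : Fin 4) (n : ℤ) (t : ℝ), j ≠ i₀ → j ≠ i₁ → Literature.Analysis.FluidPDE.TaoCascade.quadTerm 1 α₀ X j n t = 0 ∧ Literature.Analysis.FluidPDE.TaoCascade.quadTerm 1 σ X j n t = 0)) → ∃ β : ℝ, 0 < β ∧ β ≤ 1 ∧ ∃ (θ c η : ℝ) (j₀ : Fin 4) (X₀ : Fin 4 → ℝ) (P : (Fin 4 → ℤ → ℝ) → (Fin 4 → ℤ → ℝ) → Prop) (env : ℤ → ℝ), 0 ≤ θ ∧ θ ≤ 1 / 2 ∧ 0 < c ∧ 0 < η ∧ Literature.Analysis.FluidPDE.TaoCascade.InTableClass (R / β) (fun j₁ j₂ j₃ μ => α₀ j₁ j₂ j₃ μ + β * σ j₁ j₂ j₃ μ) ∧ X₀ j₀ ≠ 0 ∧ P (Literature.Analysis.FluidPDE.TaoCascade.datumState j₀ X₀) (Literature.Analysis.FluidPDE.TaoCascade.datumEnergy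 j₀ X₀) ∧ Literature.Analysis.FluidPDE.TaoCascade.FrontExists 1 θ c η (fun j₁ j₂ j₃ μ => α₀ j₁ j₂ j₃ μ + β * σ j₁ j₂ j₃ μ) P env ∧ Literature.Analysis.FluidPDE.TaoCascade.RobustStep 1 θ c η j₀ (fun j₁ j₂ j₃ μ => α₀ j₁ j₂ j₃ μ + β * σ j₁ j₂ j₃ μ) P env

/-- K2 with the same two clauses appended (draft; K2's witness satisfies them). -/
def TriggerChainTableJ : Prop :=
  ∃ R : ℝ, 1 ≤ R ∧ ∃ α₀ σ : Fin 4 → Fin 4 → Fin 4 → ℤ × ℤ × ℤ → ℝ, Literature.Analysis.FluidPDE.TaoCascade.InTableClass R α₀ ∧ (∀ β : ℝ, 0 < β → β ≤ 1 → Literature.Analysis.FluidPDE.TaoCascade.InTableClass (R / β) (fun j₁ j₂ j₃ μ => α₀ j₁ j₂ j₃ μ + β * σ j₁ j₂ j₃ μ)) ∧ ∃ (i₀ i₁ : Fin 4) (e κ K : ℝ) (d : Fin 4 → ℤ → ℝ) (H : Fin 4 → ℤ → ℝ → ℝ), i₀ ≠ i₁ ∧ 0 < e ∧ 0 < κ ∧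 0 < K ∧ (∀ X : Fin 4 → ℤ → ℝ → ℝ, (∀ i n t, i ≠ i₀ → X i n t = 0) → ∀ i n t, Literature.Analysis.FluidPDE.TaoCascade.quadTerm 1 α₀ X i n t = 0 ∧ Literature.Analysis.FluidPDE.TaoCascade.quadTerm 1 σ X i n t = 0) ∧ (∀ (j₁ j₂ j₃ : Fin 4) (μ : ℤ × ℤ × ℤ), Xor' (Xor' (j₁ = i₁) (j₂ = i₁)) (j₃ = i₁) → α₀ j₁ j₂ j₃ μ = 0 ∧ σ j₁ j₂ j₃ μ = 0) ∧ (∀ (Y : Fin 4 → ℤ → ℝ → ℝ) (i : Fin 4) (n : ℤ) (t : ℝ), Literature.Analysis.FluidPDE.TaoCascade.quadTerm 1 α₀ (fun j m s => (fun j m (_ : ℝ) => if j = i₀ ∧ m = 0 then (1 : ℝ) else 0) j m s + Y j m s) i n t - Literature.Analysis.FluidPDE.TaoCascade.quadTerm 1 α₀ (fun j m (_ : ℝ) => if j = i₀ ∧ m = 0 then (1 : ℝ) else 0) i n t - Literature.Analysis.FluidPDE.TaoCascade.quadTerm 1 α₀ Y i n t = d i n * Y i n t) ∧ d i₁ 0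 = e ∧ (∀ i n, ¬ (i = i₁ ∧ n = 0) → d i n ≤ 0) ∧ (∀ i n t, HasDerivAt (H i n) (Literature.Analysis.FluidPDE.TaoCascade.quadTerm 1 α₀ H i n t) t) ∧ (∀ i n t, n < 0 → H i n t = 0) ∧ (∀ i n t, 1 ≤ n → i ≠ i₀ → H i n t = 0) ∧ (∀ i n t, 2 ≤ n → H i n t = 0) ∧ (∀ i n, Filter.Tendsto (H i n) Filter.atBot (nhds (if i = i₀ ∧ n = 0 then (1 : ℝ) else 0))) ∧ (∀ i n, Filter.Tendsto (H i n) Filter.atTop (nhds (if i = i₀ ∧ n = 1 then (1 : ℝ) else 0))) ∧ (∀ i n t, t ≤ 0 → |H i n t - (if i = i₀ ∧ n = 0 then (1 : ℝ) else 0)| ≤ K * Real.exp (e * t)) ∧ (∀ t : ℝ, t ≤ 0 → K⁻¹ * Real.exp (e * t) ≤ |H i₁ 0 t|) ∧ (∀ i n t, 0 ≤ t → |H i n t - (if i = i₀ ∧ n = 1 then (1 : ℝ) else 0)| ≤ K * Real.exp (-(κ * t))) ∧ (∃ t : ℝ, Literature.Analysis.FluidPDE.TaoCascade.quadTerm 1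 σ H i₁ 1 t ≠ 0) ∧ (∀ (i : Fin 4) (t : ℝ), i ≠ i₀ → i ≠ i₁ → H i 0 t = 0) ∧ (∀ X : Fin 4 → ℤ → ℝ → ℝ, (∀ i n t, i ≠ i₀ → i ≠ i₁ → X i n t = 0) → ∀ (j : Fin 4) (n : ℤ) (t : ℝ), j ≠ i₀ → j ≠ i₁ → Literature.Analysis.FluidPDE.TaoCascade.quadTerm 1 α₀ X j n t = 0 ∧ Literature.Analysis.FluidPDE.TaoCascade.quadTerm 1 σ X j n t = 0)

/-- The restated crux is weaker than the filed one. -/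
theorem triggerChainFrontStepJ_of_triggerChainFrontStep
    (h : Summit.NavierStokesRegularity.NavierStokesRegularity.Theses.HeteroclinicTriggerChain.TriggerChainFrontStep) :
    TriggerChainFrontStepJ := by
  intro R hR α₀ σ hyp
  obtain ⟨hT, hTβ, i₀, i₁, e, κ, K, d, H, hne, he, hκ, hK, hpure, hpar, hsad, hde, hdle, hH, hneg, hone, htwo,
    hbot, htop, hdec, hlow, hdec', hseed, -, -⟩ := hyp
  exact h R hR α₀ σ ⟨hT, hTβ, i₀, i₁, e, κ, K, d, H, hne, he, hκ, hK, hpure, hpar, hsad, hde, hdle, hH, hneg, hone,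
    htwo, hbot, htop, hdec, hlow, hdec', hseed⟩

end Summit.NavierStokesRegularity.NavierStokesRegularity.Cruxes.TriggerChainFrontStep.RestatementP4
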